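import Literature.MathematicalPhysics.QuantumFieldTheory.Balaban1983to89.B6CubeHolderInDecayV1
import Literature.MathematicalPhysics.QuantumFieldTheory.Balaban1983to89.B6HolderPairWindowV1

/-!
# `Balaban1983to89.B6HolderPairInputsV1` — T. Bałaban, *Propagators and renormalization transformations for lattice gauge theories. II*,
# Commun. Math. Phys. **96** (1984) 223–250 [Balaban1984PropagatorsII], Prop. 2.6 (2.137) p. 247 with (2.133) p. 247 and p. 238 (`T_□`): THE PAIR
# INPUTS OF A CUBE FOR AN ADMISSIBLE GLOBAL PAIR — for a cube `□`, a direction `ν` and fine bonds `x, x′` of the same direction with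
# `|x − x′|_∞ ≤ L^{j(y(x))}`, `|x − x′|_∞ ≤ L^{j(y(x′))}` (the pairs `x, x′ ∈ Δ̃(y)`, `|x − x′| ≤ ξ` of (2.137)) near `supp h_□`, the input-localised
# PAIR majorants on the global torus **`InMajorant (P_{x,x′}·E_(ν,+)G_□) □⁺ (C·e^{ρ₁r₀}·L²t^α·pref·e^{−ρ′d_T})`** and the same for `P_{x,x′}·G_□`,
# `t = |x − x′|_∞/L^{j(y(x))}` — from the chart-frame Hölder majorants of `…B6CubeHolderInDecayV1` for close pairs (`|x − x′|_∞ ≤ L^{j₀}`, through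
# the window geometry `…B6HolderPairWindowV1`) and from the single-point majorants at `x` and `x′` for the remaining pairs (`L^{j₀} < |x − x′|_∞ ≤ L^{j₀+1}`,
# where `t ≥ L^{−2}`), given the level comparability and the block distance `d_T(y(x), y(x′)) ≤ r₀` of the pair (p38's side of the interface)

statement-level skeleton of published theorems with citation tags; proofs where landed; nothing here is a claim about the Yang–Mills mass gap

PDF held: `paper:balaban1984-cmp96-propagators-rt-ii` (journal page = PDF page + 222): p. 238 [PDF 16], p. 247 [PDF 25].  PRINT p. 247 (2.137) with [4]
(1.109) p. 35; (2.133) p. 247 (the member inequalities `(1.110)₂`, `(1.111)` for `G_□` on `T_□`).  OUR READING: the Hölder quotient of the first leg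
needs `|(E G_□μ)(x) − (E G_□μ)(x′)|` and `|(G_□μ)(x) − (G_□μ)(x′)|`; for `|x − x′|_∞ ≤ L^{j₀}` these are the member's Hölder bounds read on the global
torus (file D), for `L^{j₀} < |x − x′|_∞` the triangle inequality with the single-point bounds costs no smallness since then `t^α ≥ L^{−2}`.

CITATION HEADER (lean-in-tree rule) — WHAT IS REPRODUCED.  Phase-2 file of the `lit-balaban` typed skeleton (HOME `run/shared/lean/pub/lit-balaban/`), seat
**p22 gen 26**, free-target (2.137)₁ at k levels (p22/p38 interface, p38 INBOX 2026-08-23T23:54Z); SKELETON row **B6.Prop2.6** (cells only; decls of record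
untouched).  §1 small tools (`inMajorant_pairOp_of_points`: a pair majorant from two single-point ones; the triangle inequality of `d_T`; the level
of `□⁺`-blocks `≤ j₀ + 1`; `rpow` bookkeeping); §2 **`pairInputs_cube`**.  Theorems only; no definition, no `def … : Prop`; standard axioms.
HONEST SCOPE. (1) The level comparability `j(y(x′)) ≤ j(y(x)) + 1`, `j(y(x)) ≤ j(y(x′)) + 1` and `d_T(y(x), y(x′)) ≤ r₀` of the pair are DISPLAYED
hypotheses (p38's geometric lemmas discharge them); (2) constants `d`-, `L`-, band-dependent, not optimised (`e^{ρ₁r₀}` kept explicit); (3) V1 torus only;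
nothing on d = 4 or the continuum; NOT summit progress.  Unit `lit-balaban-p22` (gen 26), 2026-08-24.
-/

namespace Literature.MathematicalPhysics.QuantumFieldTheory.Balaban1983to89.B6HolderPairInputsV1

open Finset
open LatticeFieldCalculus
open B6MultiLevelBoxOperator (N0 bigSide)
open B6MultiLevelTorusOperator (TDomains)
open B6Eq238MultiLevelTorus (svec)
open B6Cover236MultiLevelBlocks (cubes)
open B6Geom246MultiLevelBox (bset exists_blkOf_eq lev_eq_of_blkOf_eq)
open B6Geom246MultiLevelTorus (geomT bondT connectedT)
open B6Partition118KLevelTorusCentral (Dch cc QT one_le_of_four_le)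
open B6GlobalChartV1 (PV toBox blkV1 domT)
open B6AgreeLapV1Chart (cB eB mem_cB_W)
open B6Prop26KLevelSkeletonV1 (hB ST mem_ST pref pref_nonneg blkV1_mem_QT_of_hB_ne_zero)
open B6SectAOperatorsV1 (BondIdx)
open B6RandomWalk (BlockSupp)
open B6InMajorantTransplant (InMajorant inMajorant_mono)
open B6TranslateTorusV1 (vch)
open B6Eq292MemberTorusV1 (EC)
open B6CubeWindowV1 (x0 j0 tC tC_j hx0 hfit Placed wC Gl rho two_level dist_lt_of_blkOf_mem_Q one_le_bigSide_real j0_le_level)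
open B6CubeInDecayV1 (hGin_cube hEGin_cube)
open B6CubeHolderInDecayV1 (hHEGin_cube hHGin_cube)
open B6GradLegKLevelV1 (blkV1_mem_ST_of_hB_shift_ne_zero)
open B6HolderPairMemberV1 (pairOp pairOp_mul_apply)
open B6HolderPairWindowV1 (pair_window mem_W_of_deep_one)

/-! ## §1  Tools -/

section Tools

variable {X : Type} [DecidableEq X] {g : B6.Geometry}

/-- **A PAIR MAJORANT FROM TWO SINGLE-POINT ONES** (the triangle inequality `|Tμ(x) − Tμ(x′)| ≤ |Tμ(x)| + |Tμ(x′)|`, the bound at `x′` moved to the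
block of `x` at the cost `M`). [cite: Balaban1984PropagatorsII, (2.137) p.247 with [4] (1.109) p.35; bookkeeping ours] -/
theorem inMajorant_pairOp_of_points (blk : X → g.Site) (x x' : X) {T : Module.End ℝ (X → ℝ)} {S : Set g.Site} {K : g.Site → g.Site → ℝ}
    (hK : ∀ a b, 0 ≤ K a b) (hT : InMajorant blk T S K) {M : ℝ} (hM : 0 ≤ M) (hcmp : ∀ y' ∈ S, K (blk x') y' ≤ M * K (blk x) y') :
    InMajorant blk (pairOp x x' * T) S (fun y y' => (1 + M) * K y y') := by
  intro y' hy' μ B hμ z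
  rw [pairOp_mul_apply]
  by_cases hz : z = x
  · rw [if_pos hz, hz]
    have h1 := hT y' hy' μ B hμ x
    have h2 := hT y' hy' μ B hμ x'
    calc |T μ x - T μ x'| ≤ |T μ x| + |T μ x'| := abs_sub _ _
      _ ≤ K (blk x) y' * B + M * K (blk x) y' * B := add_le_add h1 (h2.trans (mul_le_mul_of_nonneg_right (hcmp y' hy') hμ.nonneg))
      _ = (1 + M) * K (blk x) y' * B := by ring
  · rw [if_neg hz, abs_zero]
    exact mul_nonneg (mul_nonneg (by linarith) (hK _ _)) hμ.nonneg

/-- `(Λ²t)^α ≤ Λ²·t^α` for `Λ² ≥ 1`, `0 ≤ α ≤ 1`, `t ≥ 0`. [folklore] -/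
private theorem rpow_scale_le {A t α : ℝ} (hA : 1 ≤ A) (ht : 0 ≤ t) (hα1 : α ≤ 1) : (A * t) ^ α ≤ A * t ^ α := by
  rw [Real.mul_rpow (by linarith) ht]
  refine mul_le_mul_of_nonneg_right ?_ (Real.rpow_nonneg ht _)
  calc A ^ α ≤ A ^ (1 : ℝ) := Real.rpow_le_rpow_of_exponent_le hA hα1
    _ = A := Real.rpow_one A

/-- `t ≤ t^α` for `0 ≤ t ≤ 1`, `0 ≤ α ≤ 1`. [folklore] -/
private theorem le_rpow_self {t α : ℝ} (ht0 : 0 ≤ t) (ht1 : t ≤ 1) (hα1 : α ≤ 1) : t ≤ t ^ α := by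
  rcases eq_or_lt_of_le ht0 with h | h
  · rw [← h]; exact Real.rpow_nonneg le_rfl _
  · calc t = t ^ (1 : ℝ) := (Real.rpow_one t).symm
      _ ≤ t ^ α := Real.rpow_le_rpow_of_exponent_ge h ht1 hα1

/-- `1 ≤ A·t^α` once `A⁻¹ ≤ t ≤ 1`, `A ≥ 1`, `0 ≤ α ≤ 1`. [folklore] -/
private theorem one_le_mul_rpow {A t α : ℝ} (hA : 1 ≤ A) (ht : A⁻¹ ≤ t) (ht1 : t ≤ 1) (hα1 : α ≤ 1) : 1 ≤ A * t ^ α := by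
  have hA0 : 0 < A := by linarith
  have ht0 : 0 < t := lt_of_lt_of_le (inv_pos.2 hA0) ht
  have h1 : A⁻¹ ≤ t ^ α := ht.trans ((Real.rpow_one t).symm.le.trans (Real.rpow_le_rpow_of_exponent_ge ht0 ht1 hα1))
  calc (1 : ℝ) = A * A⁻¹ := (mul_inv_cancel₀ hA0.ne').symm
    _ ≤ A * t ^ α := mul_le_mul_of_nonneg_left h1 hA0.le

end Tools

section Geom

variable {d ℓ : ℕ} {Mh k R : ℕ} {P' : Fin (d + 1) → ℕ} {D : TDomains d ℓ Mh k P' R}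

/-- the triangle inequality of the torus block distance `d_T`. [cite: Balaban1984PropagatorsII, (2.46) p.231] -/
theorem geomT_dist_triangle (hMh1 : 1 ≤ Mh) (hP : ∀ μ, 1 ≤ P' μ) (a b e : (geomT D).Site) :
    (geomT D).dist a e ≤ (geomT D).dist a b + (geomT D).dist b e := by
  change (((bondT D).dist a e : ℕ) : ℝ) ≤ (((bondT D).dist a b : ℕ) : ℝ) + (((bondT D).dist b e : ℕ) : ℝ)
  exact_mod_cast (connectedT (D := D) hMh1 hP).dist_triangle (u := a) (v := b) (w := e)

/-- `d_T` is symmetric. [cite: Balaban1984PropagatorsII, (2.46) p.231] -/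
theorem geomT_dist_comm (a b : (geomT D).Site) : (geomT D).dist a b = (geomT D).dist b a := by
  change (((bondT D).dist a b : ℕ) : ℝ) = (((bondT D).dist b a : ℕ) : ℝ)
  rw [SimpleGraph.dist_comm]

/-- **THE BLOCKS OF `□⁺` HAVE LEVEL `≤ j₀ + 1`** (they lie in the two-level ball). [cite: Balaban1984PropagatorsII, (2.2) p.224, p.235, p.238] -/
theorem level_le_j0_succ_of_mem_ST (hMh : 2 ≤ Mh) (hR2 : 2 * (ℓ + 1) ^ 2 ≤ R) (hL : Odd (ℓ + 1) ∧ 1 < ℓ + 1) {hMh1 : 1 ≤ Mh} {hP4 : ∀ μ, 4 ≤ P' μ}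
    (c : ↥(cubes D.toDomains)) {y : ↥(bset D.toDomains)} (hy : y ∈ ST D hMh1 hP4 c) : y.1.1 ≤ j0 hMh1 hP4 c + 1 := by
  have hy' : y ∈ QT D hMh1 hP4 c := (mem_ST D hMh1 hP4 c y).1 hy
  obtain ⟨y', hy'', rfl⟩ := Finset.mem_image.1 hy'
  rw [B6TranslateTorusV1.blkMap_fst D hMh1 (fun μ => le_trans (by norm_num) (hP4 μ))]
  obtain ⟨z, rfl⟩ := exists_blkOf_eq (Dch D c) y'
  have hR : 2 * (ℓ + 1) ≤ R := le_trans (by nlinarith : 2 * (ℓ + 1) ≤ 2 * (ℓ + 1) ^ 2) hR2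
  have h := dist_lt_of_blkOf_mem_Q hMh1 hP4 c hMh hR hy''
  have hS := one_le_bigSide_real (ℓ := ℓ) hMh1 c.1.1
  have hl : (0 : ℝ) ≤ ℓ := Nat.cast_nonneg _
  have h2 := (two_level hMh1 hP4 c hL hR2 (w := z) (h.trans (by unfold rho; nlinarith))).2
  rwa [lev_eq_of_blkOf_eq (Dch D c) rfl] at h2

end Geom

/-! ## §2  The pair inputs of a cube for an admissible global pair -/

section Cube

variable {d ℓ : ℕ} {hd : 1 ≤ d + 1} {hL : Odd (ℓ + 1) ∧ 1 < ℓ + 1} {m K : ℕ} {Mh k R : ℕ} {P' : Fin (d + 1) → ℕ}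

/-- `x − 0 = x` for bonds. [folklore] -/
private theorem translate_neg_add (v : Site (PV d ℓ m K hd hL) 0) (x : PBond (PV d ℓ m K hd hL) 0) : (x.translate (-v)).translate v = x := by
  rw [PBond.translate_translate, neg_add_cancel]; cases x; simp [PBond.translate]

open Classical in
/-- **THE PAIR INPUTS OF A CUBE FOR AN ADMISSIBLE GLOBAL PAIR** (`L ≥ 5`): there are `ρ′ > 0`, `ρ₁ ≥ 0` and, for every `0 ≤ α < 1`, `C_P ≥ 0` (on `d, L`,
`α` and the weight band) such that on every admissible V1 torus (`M_h = Lᵃ ≥ 8`, `R ≥ 2L²`, `P′ ≥ 5`, cube placed), for every `c′`, weights, direction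
`ν`, cube `□`, `r₀ ≥ 0` and fine bonds `x, x′` with: the same direction, `|x − x′|_∞ ≤ L^{j(y(x))}`, `|x − x′|_∞ ≤ L^{j(y(x′))}`, `h_□ ≠ 0` at `x`, `x + e_ν`,
`x′` or `x′ + e_ν`, `j(y(x′)) ≤ j(y(x)) + 1`, `j(y(x)) ≤ j(y(x′)) + 1`, `d_T(y(x), y(x′)) ≤ r₀`:
`InMajorant (P_{x,x′}·E_(ν,+)G_□) □⁺ (τ·pref·e^{−ρ′d_T})` and `InMajorant (P_{x,x′}·G_□) □⁺ (τ·pref·e^{−ρ′d_T})` with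
`τ = C_P·e^{ρ₁r₀}·L²·t^α`, `t = |x − x′|_∞/L^{j(y(x))}` — the member's Hölder inequalities (2.133)/(1.111) read on the global torus for the pair.
[cite: Balaban1984PropagatorsII, Prop. 2.6 (2.137) p.247, (2.133) p.247, p.238 (T_□); Balaban1984PropagatorsI, (1.109)–(1.111) p.35] -/
theorem pairInputs_cube (d ℓ : ℕ) (hd : 1 ≤ d + 1) (hL : Odd (ℓ + 1) ∧ 1 < ℓ + 1) {a₀ a₁ : ℝ} (ha₀ : 0 < a₀) (ha₁ : a₀ ≤ a₁) :
    ∃ ρ' : ℝ, 0 < ρ' ∧ ∃ ρ₁ : ℝ, 0 ≤ ρ₁ ∧ ∀ α : ℝ, 0 ≤ α → α < 1 → ∃ CP : ℝ, 0 ≤ CP ∧ ∀ (m K : ℕ) {Mh k R : ℕ} {P' : Fin (d + 1) → ℕ}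
      (hN : ∀ μ, N0 ℓ Mh k P' μ = (PV d ℓ m K hd hL).sitesPerDir 0) (D : TDomains d ℓ Mh k P' R) (hk : k ≤ m + K)
      (hMh1 : 1 ≤ Mh) (hP4 : ∀ μ, 4 ≤ P' μ) {a : ℕ} (hMha : Mh = (ℓ + 1) ^ a) (_ : 8 ≤ Mh) (_ : 2 * (ℓ + 1) ^ 2 ≤ R) (_ : ∀ μ, 5 ≤ P' μ)
      (_ : 4 ≤ ℓ) (c : ↥(cubes D.toDomains)) (hpl : Placed ℓ k P' c.1) (w : BondIdx (domT hN D hk) → ℝ) (cf : ℝ) (ν : Fin (d + 1))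
      (r₀ : ℝ) (_ : 0 ≤ r₀) (x x' : PBond (PV d ℓ m K hd hL) 0) (_ : x.dir = x'.dir)
      (_ : supDist x.src x'.src ≤ (ℓ + 1) ^ (blkV1 hN D x).1.1) (_ : supDist x.src x'.src ≤ (ℓ + 1) ^ (blkV1 hN D x').1.1)
      (_ : hB hN D c x ≠ 0 ∨ hB hN D c ⟨x.src.shift ν, x.dir⟩ ≠ 0 ∨ hB hN D c x' ≠ 0 ∨ hB hN D c ⟨x'.src.shift ν, x'.dir⟩ ≠ 0)
      (_ : (blkV1 hN D x').1.1 ≤ (blkV1 hN D x).1.1 + 1) (_ : (blkV1 hN D x).1.1 ≤ (blkV1 hN D x').1.1 + 1)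
      (_ : (geomT D).dist (blkV1 hN D x) (blkV1 hN D x') ≤ r₀),
      InMajorant (g := geomT D) (blkV1 hN D)
        (pairOp x x' * (EC hN hk hMh1 hP4 hMha c ha₁ hpl w cf (ν, true) * Gl hN hk hMh1 hP4 hMha c ha₁ hpl w cf)) (ST D hMh1 hP4 c)
        (fun y y' => (CP * Real.exp (ρ₁ * r₀) * ((((ℓ + 1 : ℕ) : ℝ)) ^ 2 *
            ((((supDist x.src x'.src : ℕ) : ℝ) / (((ℓ + 1 : ℕ) : ℝ)) ^ (blkV1 hN D x).1.1) ^ α))) *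
          pref cf y * Real.exp (-(ρ' * (geomT D).dist y y'))) ∧
      InMajorant (g := geomT D) (blkV1 hN D) (pairOp x x' * Gl hN hk hMh1 hP4 hMha c ha₁ hpl w cf) (ST D hMh1 hP4 c)
        (fun y y' => (CP * Real.exp (ρ₁ * r₀) * ((((ℓ + 1 : ℕ) : ℝ)) ^ 2 *
            ((((supDist x.src x'.src : ℕ) : ℝ) / (((ℓ + 1 : ℕ) : ℝ)) ^ (blkV1 hN D x).1.1) ^ α))) *
          pref cf y * Real.exp (-(ρ' * (geomT D).dist y y'))) := by
  obtain ⟨δA, hδA, hAα⟩ := hHEGin_cube d ℓ hd hL ha₀ ha₁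
  obtain ⟨δC, hδC, CCH, hCCH, hCmem⟩ := hHGin_cube d ℓ hd hL ha₀ ha₁
  obtain ⟨ρG, hρG, CG, hCG, hGin⟩ := hGin_cube d ℓ hd hL ha₀ ha₁
  obtain ⟨ρE, hρE, CE, hCE, hEGin⟩ := hEGin_cube d ℓ hd hL ha₀ ha₁
  refine ⟨min (min δA δC) (min ρG ρE), lt_min (lt_min hδA hδC) (lt_min hρG hρE), max ρG ρE, le_max_of_le_left hρG.le, fun α hα0 hα1 => ?_⟩
  obtain ⟨CAH, hCAH, hAmem⟩ := hAα α hα0 hα1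
  refine ⟨CAH + CCH + (1 + (((ℓ + 1 : ℕ) : ℝ)) ^ 2) * (CE + CG), by positivity, ?_⟩
  intro m K Mh k R P' hN D hk hMh1 hP4 a hMha hM8 hR2 hP5 hℓ c hpl w cf ν r₀ hr₀ x x' hdir hs1 hs2 hact hl1 hl2 hdT
  have hMh : 2 ≤ Mh := le_trans (by norm_num) hM8
  have hR : 2 * (ℓ + 1) ≤ R := le_trans (by nlinarith : 2 * (ℓ + 1) ≤ 2 * (ℓ + 1) ^ 2) hR2
  have hP : ∀ μ, 1 ≤ P' μ := one_le_of_four_le hP4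
  have hdnn : ∀ y y' : (geomT D).Site, 0 ≤ (geomT D).dist y y' := fun _ _ => Nat.cast_nonneg _
  set Λ : ℝ := ((ℓ + 1 : ℕ) : ℝ) with hΛ
  have hΛ1 : (1 : ℝ) ≤ Λ := by rw [hΛ]; exact_mod_cast Nat.succ_pos ℓ
  have hΛ2 : (1 : ℝ) ≤ Λ ^ 2 := by nlinarith
  set s : ℝ := ((supDist x.src x'.src : ℕ) : ℝ) with hs
  have hs0 : 0 ≤ s := Nat.cast_nonneg _
  set jx : ℕ := (blkV1 hN D x).1.1 with hjx
  set t : ℝ := s / Λ ^ jx with ht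
  have hJx : (0 : ℝ) < Λ ^ jx := by positivity
  have ht0 : 0 ≤ t := by positivity
  have ht1 : t ≤ 1 := by
    rw [ht, div_le_one hJx, hs, hΛ]; exact_mod_cast hs1
  set E : ℝ := Real.exp (max ρG ρE * r₀) with hE_def
  have hE1 : 1 ≤ E := Real.one_le_exp (mul_nonneg (le_max_of_le_left hρG.le) hr₀)
  -- the active block is in `□⁺`, its level is `≤ j₀ + 1`; hence `|x − x′|_∞ ≤ L^{j₀+1}` and `j(y(x)) ≤ j₀ + 2`
  have hST : blkV1 hN D x ∈ ST D hMh1 hP4 c ∨ blkV1 hN D x' ∈ ST D hMh1 hP4 c := by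
    rcases hact with h | h | h | h
    · exact Or.inl ((mem_ST D hMh1 hP4 c _).2 (blkV1_mem_QT_of_hB_ne_zero hN D hMh hR hP4 c h))
    · exact Or.inl (blkV1_mem_ST_of_hB_shift_ne_zero hN hMh1 hP4 c hM8 hR hP5 ν h)
    · exact Or.inr ((mem_ST D hMh1 hP4 c _).2 (blkV1_mem_QT_of_hB_ne_zero hN D hMh hR hP4 c h))
    · exact Or.inr (blkV1_mem_ST_of_hB_shift_ne_zero hN hMh1 hP4 c hM8 hR hP5 ν h)
  have hjx2 : jx ≤ j0 hMh1 hP4 c + 2 := by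
    rcases hST with h | h
    · have := level_le_j0_succ_of_mem_ST hMh hR2 hL c h; omega
    · have := level_le_j0_succ_of_mem_ST hMh hR2 hL c h; omega
  have hsD : supDist x.src x'.src ≤ (ℓ + 1) ^ (j0 hMh1 hP4 c + 1) := by
    rcases hST with h | h
    · exact hs1.trans (Nat.pow_le_pow_right (Nat.succ_pos ℓ) (level_le_j0_succ_of_mem_ST hMh hR2 hL c h))
    · exact hs2.trans (Nat.pow_le_pow_right (Nat.succ_pos ℓ) (level_le_j0_succ_of_mem_ST hMh hR2 hL c h))
  -- rates
  have hexp : ∀ {r : ℝ}, min (min δA δC) (min ρG ρE) ≤ r → ∀ u : ℝ, 0 ≤ u →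
      Real.exp (-(r * u)) ≤ Real.exp (-(min (min δA δC) (min ρG ρE) * u)) :=
    fun hr u hu => Real.exp_le_exp.mpr (neg_le_neg (mul_le_mul_of_nonneg_right hr hu))
  have hrA : min (min δA δC) (min ρG ρE) ≤ δA := (min_le_left _ _).trans (min_le_left _ _)
  have hrC : min (min δA δC) (min ρG ρE) ≤ δC := (min_le_left _ _).trans (min_le_right _ _)
  have hrG : min (min δA δC) (min ρG ρE) ≤ ρG := (min_le_right _ _).trans (min_le_left _ _)
  have hrE : min (min δA δC) (min ρG ρE) ≤ ρE := (min_le_right _ _).trans (min_le_right _ _)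
  -- the target size `τ = C_P·E·L²t^α`
  set τ : ℝ := (CAH + CCH + (1 + Λ ^ 2) * (CE + CG)) * E * (Λ ^ 2 * t ^ α) with hτ
  have hLt : 0 ≤ Λ ^ 2 * t ^ α := mul_nonneg (by positivity) (Real.rpow_nonneg ht0 _)
  have hτnn : 0 ≤ τ := by rw [hτ]; positivity
  -- generic final step: from an InMajorant with kernel `τ₀·pref·e^{−r d}`, `τ₀ ≤ τ`, `r ≥ ρ′`
  have fin : ∀ {T : Module.End ℝ (PBond (PV d ℓ m K hd hL) 0 → ℝ)} {τ₀ r : ℝ}, τ₀ ≤ τ → min (min δA δC) (min ρG ρE) ≤ r →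
      InMajorant (g := geomT D) (blkV1 hN D) T (ST D hMh1 hP4 c) (fun y y' => τ₀ * pref cf y * Real.exp (-(r * (geomT D).dist y y'))) →
      InMajorant (g := geomT D) (blkV1 hN D) T (ST D hMh1 hP4 c)
        (fun y y' => τ * pref cf y * Real.exp (-(min (min δA δC) (min ρG ρE) * (geomT D).dist y y'))) := by
    intro T τ₀ r hτ₀ hr hT
    refine inMajorant_mono (g := geomT D) (blkV1 hN D) hT fun y y' _ => ?_
    have hp := pref_nonneg cf y
    have := hexp hr _ (hdnn y y')
    calc τ₀ * pref cf y * Real.exp (-(r * (geomT D).dist y y')) ≤ τ * pref cf y * Real.exp (-(r * (geomT D).dist y y')) := by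
          gcongr
      _ ≤ _ := by gcongr
  by_cases hclose : supDist x.src x'.src ≤ (ℓ + 1) ^ j0 hMh1 hP4 c
  · -- CLOSE PAIRS: the member's Hölder majorants through the window
    obtain ⟨hdx, hdx', hsm⟩ := pair_window hN hk hMh1 hP4 hMha c ha₁ hM8 hR2 hpl w cf ν hact hsD
    obtain ⟨hWx, -⟩ := mem_W_of_deep_one hN hk hMh1 hP4 hMha c ha₁ (hpl := hpl) (w := w) (cf := cf)
      (b := x.translate (-vch Mh k (svec ℓ k c.1.1 c.1.2))) hdx ν
    obtain ⟨hWx', -⟩ := mem_W_of_deep_one hN hk hMh1 hP4 hMha c ha₁ (hpl := hpl) (w := w) (cf := cf)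
      (b := x'.translate (-vch Mh k (svec ℓ k c.1.1 c.1.2))) hdx' ν
    have hdir' : (x.translate (-vch Mh k (svec ℓ k c.1.1 c.1.2))).dir = (x'.translate (-vch Mh k (svec ℓ k c.1.1 c.1.2))).dir := by
      simp [PBond.translate_dir, hdir]
    have hsm' := hsm.trans hclose
    rw [← tC_j hN hk hMh1 hP4 c ha₁ a (wC hN hk c w) cf] at hsm'
    have hA := hAmem m K hN D hk hMh1 hP4 hMha hMh hR2 hℓ c hpl w cf ν _ _ hWx hWx' hdir' hsm'
    have hC := hCmem m K hN D hk hMh1 hP4 hMha hMh hR2 hℓ c hpl w cf _ _ hWx hWx' hdir' hsm'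
    rw [translate_neg_add, translate_neg_add] at hA hC
    -- the member's relative distance: `s_m/L^{j₀} ≤ s/L^{j₀} ≤ L²·t`
    have hsms : ((supDist (eB (tC hN hk hMh1 hP4 c ha₁ a (wC hN hk c w) cf) (x0 ℓ Mh k c.1) (x.translate (-vch Mh k (svec ℓ k c.1.1 c.1.2)))).src
        (eB (tC hN hk hMh1 hP4 c ha₁ a (wC hN hk c w) cf) (x0 ℓ Mh k c.1) (x'.translate (-vch Mh k (svec ℓ k c.1.1 c.1.2)))).src : ℕ) : ℝ) ≤ s := by
      rw [hs]; exact_mod_cast hsm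
    have hsm0 : (0 : ℝ) ≤ ((supDist (eB (tC hN hk hMh1 hP4 c ha₁ a (wC hN hk c w) cf) (x0 ℓ Mh k c.1) (x.translate (-vch Mh k (svec ℓ k c.1.1 c.1.2)))).src
        (eB (tC hN hk hMh1 hP4 c ha₁ a (wC hN hk c w) cf) (x0 ℓ Mh k c.1) (x'.translate (-vch Mh k (svec ℓ k c.1.1 c.1.2)))).src : ℕ) : ℝ) :=
      Nat.cast_nonneg _
    generalize ((supDist (eB (tC hN hk hMh1 hP4 c ha₁ a (wC hN hk c w) cf) (x0 ℓ Mh k c.1) (x.translate (-vch Mh k (svec ℓ k c.1.1 c.1.2)))).src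
        (eB (tC hN hk hMh1 hP4 c ha₁ a (wC hN hk c w) cf) (x0 ℓ Mh k c.1) (x'.translate (-vch Mh k (svec ℓ k c.1.1 c.1.2)))).src : ℕ) : ℝ) = sm
      at hA hC hsms hsm0
    have hJ : (((ℓ + 1 : ℕ) : ℝ)) ^ (tC hN hk hMh1 hP4 c ha₁ a (wC hN hk c w) cf).j = Λ ^ j0 hMh1 hP4 c := by rw [tC_j]
    rw [hJ] at hA hC
    have hJ0 : (0 : ℝ) < Λ ^ j0 hMh1 hP4 c := by positivity
    have hq : sm / Λ ^ j0 hMh1 hP4 c ≤ Λ ^ 2 * t := by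
      have hpow : Λ ^ jx ≤ Λ ^ 2 * Λ ^ j0 hMh1 hP4 c := by rw [← pow_add]; exact pow_le_pow_right₀ hΛ1 (by omega)
      rw [div_le_iff₀ hJ0, ht]
      calc sm ≤ s := hsms
        _ = s / Λ ^ jx * Λ ^ jx := by field_simp
        _ ≤ s / Λ ^ jx * (Λ ^ 2 * Λ ^ j0 hMh1 hP4 c) := mul_le_mul_of_nonneg_left hpow (by positivity)
        _ = Λ ^ 2 * (s / Λ ^ jx) * Λ ^ j0 hMh1 hP4 c := by ring
    have hsm0' : 0 ≤ sm / Λ ^ j0 hMh1 hP4 c := by positivity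
    have hqα : (sm / Λ ^ j0 hMh1 hP4 c) ^ α ≤ Λ ^ 2 * t ^ α :=
      (Real.rpow_le_rpow hsm0' hq hα0).trans (rpow_scale_le hΛ2 ht0 hα1.le)
    have hq1 : sm / Λ ^ j0 hMh1 hP4 c ≤ Λ ^ 2 * t ^ α :=
      hq.trans (mul_le_mul_of_nonneg_left (le_rpow_self ht0 ht1 hα1.le) (by positivity))
    have hsumE : CAH + CCH + (1 + Λ ^ 2) * (CE + CG) ≤ (CAH + CCH + (1 + Λ ^ 2) * (CE + CG)) * E :=
      le_mul_of_one_le_right (by positivity) hE1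
    have h00 : 0 ≤ (1 + Λ ^ 2) * (CE + CG) := by positivity
    have hCP1 : CAH ≤ (CAH + CCH + (1 + Λ ^ 2) * (CE + CG)) * E := by linarith only [hsumE, hCCH, h00]
    have hCP2 : CCH ≤ (CAH + CCH + (1 + Λ ^ 2) * (CE + CG)) * E := by linarith only [hsumE, hCAH, h00]
    have hτA : CAH * (sm / Λ ^ j0 hMh1 hP4 c) ^ α ≤ τ := by
      rw [hτ]; exact mul_le_mul hCP1 hqα (Real.rpow_nonneg hsm0' _) (by positivity)
    have hτC : CCH * (sm / Λ ^ j0 hMh1 hP4 c) ≤ τ := by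
      rw [hτ]; exact mul_le_mul hCP2 hq1 hsm0' (by positivity)
    exact ⟨fin hτA hrA (by simpa only [mul_assoc] using hA), fin hτC hrC (by simpa only [mul_assoc] using hC)⟩
  · -- REMAINING PAIRS (`L^{j₀} < |x − x′|_∞ ≤ L^{j₀+1}`): the two single-point majorants and the triangle inequality; here `L²t^α ≥ 1`
    push Not at hclose
    have hE' := hEGin m K hN D hk hMh1 hP4 hMha hMh hR2 hℓ c hpl w cf (ν, true)
    have hG' := hGin m K hN D hk hMh1 hP4 hMha hMh hR2 hℓ c hpl w cf
    -- `L²·t^α ≥ 1`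
    have htlow : (Λ ^ 2)⁻¹ ≤ t := by
      have h1 : Λ ^ j0 hMh1 hP4 c ≤ s := by
        rw [hs, hΛ]; exact_mod_cast (Nat.le_of_lt hclose)
      have hpow : Λ ^ jx ≤ Λ ^ 2 * Λ ^ j0 hMh1 hP4 c := by rw [← pow_add]; exact pow_le_pow_right₀ hΛ1 (by omega)
      rw [ht, le_div_iff₀ hJx, inv_mul_le_iff₀ (by positivity : (0:ℝ) < Λ ^ 2)]
      exact hpow.trans (mul_le_mul_of_nonneg_left h1 (by positivity))
    have hone : 1 ≤ Λ ^ 2 * t ^ α := one_le_mul_rpow hΛ2 htlow ht1 hα1.le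
    -- moving the bound at `y(x′)` to `y(x)`: `pref(y(x′)) ≤ L²pref(y(x))`, `e^{−ρd(y(x′),·)} ≤ e^{ρr₀}e^{−ρd(y(x),·)}`
    have hpref : pref cf (blkV1 hN D x') ≤ Λ ^ 2 * pref cf (blkV1 hN D x) := by
      have h1 : Λ ^ (blkV1 hN D x').1.1 ≤ Λ * Λ ^ jx := by
        rw [← pow_succ']; exact pow_le_pow_right₀ hΛ1 (by omega)
      show (Λ ^ (blkV1 hN D x').1.1 / cf) ^ 2 ≤ Λ ^ 2 * (Λ ^ jx / cf) ^ 2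
      rw [div_pow, div_pow, mul_div_assoc']
      by_cases hcf : cf = 0
      · simp [hcf]
      · rw [div_le_div_iff_of_pos_right (by positivity), ← mul_pow]
        exact pow_le_pow_left₀ (by positivity) h1 2
    have hdist : ∀ y' : (geomT D).Site, (geomT D).dist (blkV1 hN D x) y' - r₀ ≤ (geomT D).dist (blkV1 hN D x') y' := by
      intro y'
      have h1 := geomT_dist_triangle hMh1 hP (blkV1 hN D x) (blkV1 hN D x') y'
      linarith only [h1, hdT]
    have hcmpK : ∀ {C ρ : ℝ}, 0 ≤ C → 0 < ρ → ρ ≤ max ρG ρE → ∀ y' : (geomT D).Site,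
        C * pref cf (blkV1 hN D x') * Real.exp (-(ρ * (geomT D).dist (blkV1 hN D x') y')) ≤
          (Λ ^ 2 * E) * (C * pref cf (blkV1 hN D x) * Real.exp (-(ρ * (geomT D).dist (blkV1 hN D x) y'))) := by
      intro C ρ hC hρ hρm y'
      have h1 : Real.exp (-(ρ * (geomT D).dist (blkV1 hN D x') y')) ≤
          Real.exp (ρ * r₀) * Real.exp (-(ρ * (geomT D).dist (blkV1 hN D x) y')) := by
        rw [← Real.exp_add]
        refine Real.exp_le_exp.mpr ?_
        have := mul_le_mul_of_nonneg_left (hdist y') hρ.le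
        rw [mul_sub] at this
        linarith only [this]
      have h2 : Real.exp (ρ * r₀) ≤ E := Real.exp_le_exp.mpr (mul_le_mul_of_nonneg_right hρm hr₀)
      have hpx := pref_nonneg cf (blkV1 hN D x)
      calc C * pref cf (blkV1 hN D x') * Real.exp (-(ρ * (geomT D).dist (blkV1 hN D x') y'))
          ≤ C * (Λ ^ 2 * pref cf (blkV1 hN D x)) * (E * Real.exp (-(ρ * (geomT D).dist (blkV1 hN D x) y'))) :=
            mul_le_mul (mul_le_mul_of_nonneg_left hpref hC) (h1.trans (mul_le_mul_of_nonneg_right h2 (Real.exp_nonneg _)))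
              (Real.exp_nonneg _) (by positivity)
        _ = (Λ ^ 2 * E) * (C * pref cf (blkV1 hN D x) * Real.exp (-(ρ * (geomT D).dist (blkV1 hN D x) y'))) := by ring
    have hM0 : 0 ≤ Λ ^ 2 * E := by positivity
    have hA0 := inMajorant_pairOp_of_points (g := geomT D) (blkV1 hN D) x x'
      (K := fun y y' => CE * pref cf y * Real.exp (-(ρE * (geomT D).dist y y')))
      (fun a b => by have := pref_nonneg cf a; positivity) hE' hM0 (fun y' _ => hcmpK hCE hρE (le_max_right _ _) y')
    have hC0 := inMajorant_pairOp_of_points (g := geomT D) (blkV1 hN D) x x'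
      (K := fun y y' => CG * pref cf y * Real.exp (-(ρG * (geomT D).dist y y')))
      (fun a b => by have := pref_nonneg cf a; positivity) hG' hM0 (fun y' _ => hcmpK hCG hρG (le_max_left _ _) y')
    have hA1 : InMajorant (g := geomT D) (blkV1 hN D)
        (pairOp x x' * (EC hN hk hMh1 hP4 hMha c ha₁ hpl w cf (ν, true) * Gl hN hk hMh1 hP4 hMha c ha₁ hpl w cf)) (ST D hMh1 hP4 c)
        (fun y y' => ((1 + Λ ^ 2 * E) * CE) * pref cf y * Real.exp (-(ρE * (geomT D).dist y y'))) :=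
      inMajorant_mono (g := geomT D) (blkV1 hN D) hA0 fun y y' _ => le_of_eq (by ring)
    have hC1 : InMajorant (g := geomT D) (blkV1 hN D) (pairOp x x' * Gl hN hk hMh1 hP4 hMha c ha₁ hpl w cf) (ST D hMh1 hP4 c)
        (fun y y' => ((1 + Λ ^ 2 * E) * CG) * pref cf y * Real.exp (-(ρG * (geomT D).dist y y'))) :=
      inMajorant_mono (g := geomT D) (blkV1 hN D) hC0 fun y y' _ => le_of_eq (by ring)
    -- `(1 + L²E)·C ≤ (1 + L²)·C·E ≤ C_P·E ≤ C_P·E·(L²t^α) = τ`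
    have hkey : ∀ {C : ℝ}, 0 ≤ C → C ≤ CE + CG → (1 + Λ ^ 2 * E) * C ≤ τ := by
      intro C hC hCle
      rw [hτ]
      have h1a : 1 + Λ ^ 2 * E ≤ (1 + Λ ^ 2) * E := by
        calc 1 + Λ ^ 2 * E ≤ E + Λ ^ 2 * E := by linarith only [hE1]
          _ = (1 + Λ ^ 2) * E := by ring
      have h1 : (1 + Λ ^ 2 * E) * C ≤ ((1 + Λ ^ 2) * (CE + CG)) * E := by
        calc (1 + Λ ^ 2 * E) * C ≤ ((1 + Λ ^ 2) * E) * (CE + CG) := mul_le_mul h1a hCle hC (by positivity)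
          _ = ((1 + Λ ^ 2) * (CE + CG)) * E := by ring
      have h2 : ((1 + Λ ^ 2) * (CE + CG)) * E ≤ (CAH + CCH + (1 + Λ ^ 2) * (CE + CG)) * E :=
        mul_le_mul_of_nonneg_right (by linarith only [hCAH, hCCH]) (by positivity)
      calc (1 + Λ ^ 2 * E) * C ≤ (CAH + CCH + (1 + Λ ^ 2) * (CE + CG)) * E * 1 := by rw [mul_one]; exact h1.trans h2
        _ ≤ (CAH + CCH + (1 + Λ ^ 2) * (CE + CG)) * E * (Λ ^ 2 * t ^ α) := mul_le_mul_of_nonneg_left hone (by positivity)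
    exact ⟨fin (hkey hCE (by linarith only [hCG])) hrE hA1, fin (hkey hCG (by linarith only [hCE])) hrG hC1⟩

end Cube

end Literature.MathematicalPhysics.QuantumFieldTheory.Balaban1983to89.B6HolderPairInputsV1
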